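import Summits.BirchSwinnertonDyer.BirchSwinnertonDyer.Theorems.PublishedInputsGreenbergLemma34InflationCocycles
import HarnessLib

set_option linter.dupNamespace false -- `…BirchSwinnertonDyer.BirchSwinnertonDyer…` is the cell's nested layout (D-0017)
set_option autoImplicit false

/-!
# Greenberg LNM 1716 Lemma 3.4 at `n = 0`, step 1b: `#𝒦_{v,0}[p^∞] = #(E(K_{∞,η})/(g − 1))[p^∞]` EXACTLY,
# with NO divisibility hypothesis

Seat `bsd-inputs-k4-p1` (gen 5; LADDER-BSD D-0154 KEY (147)(f) «prove the printed input», row 1 K4 INPUTS; Greenberg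
1999), `--supports stmt-BirchSwinnertonDyer-20309`. THEOREMS ONLY (no definition, no named fact, no `sorry`).

R. Greenberg, *Iwasawa theory for elliptic curves*, LNM 1716 (1999), §3 (pp. 86–89): `ker(r_v) ≅ H¹(Γ_v, E(K_{∞,η}))`
with `Γ_v ≅ ℤ_p` pro-cyclic, so `#ker(r_v)[p^∞] = #(E(K_{∞,η})/(g − 1))[p^∞]`. The tree (cell b2b-bsdres, file 52,
`Rank1Residual.Additive.natCard_localTowerKerPrimary_zero_eq`) has this under (hdiv) «`E(K_∞·E)` `p`-divisible modulo
torsion», which fails at `v ∣ p`. With the inflation cocycles of the prequel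
(`ZpExtension.exists_cocycle_vanishing_apply_eq_of_nsmul_eq_sub`) the hypothesis disappears:

* `natCard_primary_subgroupResKer_eq_of_isTopGenerator` — for ANY `ℤ_p`-extension `κE` of a field `E` of
  characteristic `0` with topological generator `g` and ANY discrete `Γ_E`-module `M` with continuous orbit maps:
  `#{x ∈ ker(res : H¹(Γ_E, M) → H¹(ker κE, M)) : p-power torsion} = #(M^{ker κE}/(g − 1))[p^∞]` (used for the formal
  group `Ê(𝔪̄) ⊆ E(K̄_v)`).
* **`natCard_localTowerKerPrimary_zero_eq_of_isTopGenerator`** — for an elliptic curve `W/K`, a `ℤ_p`-extension `κ` of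
  `K`, a `K`-field `E` of characteristic `0`, and ANY `ℤ_p`-extension `κE` of `E` with `ker κE = Gal(K̄_E/K_∞·E)` and
  topological generator `g`: **`#𝒦_{E,0}[p^∞] = #(E(K̄_E)^{H_{E,∞}}/(g − 1))[p^∞]`** (as `Nat.card`, finite or not).

HONEST FRAMING: TOOL theorems; closes nothing; no summit statement is proved; BSD is not proved by any of this.

References: [GreenbergLNM1716] §3 Lemmas 3.1–3.4 (pp. 86–89); [SerreGaloisCohomology1997] I.§2.6, XIII.§1.
-/

noncomputable section

open scoped Classical

universe u

namespace Summit.BirchSwinnertonDyer.BirchSwinnertonDyer.Theorems.InputsGreenbergLemma34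

open Literature.NumberTheory.EllipticCurves Literature.NumberTheory.GaloisRepresentations
  Literature.NumberTheory.EllipticCurves.ResKernel Literature.NumberTheory.EllipticCurves.PrimaryCoinvariants
  Literature.NumberTheory.EllipticCurves.LayerCocycle ZpExtension

/-! ## §3 The local counts for a `ℤ_p`-extension of a field and its topological generator -/

section Local

variable {E : Type u} [Field E] [CharZero E] {p : ℕ} [hp : Fact p.Prime] (κE : ZpExtension E p)

/-- **`#{x ∈ ker(res : H¹(Γ_E, M) → H¹(ker κE, M)) : p-power torsion} = #(M^{ker κE}/(g − 1))[p^∞]`** for ANY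
`ℤ_p`-extension `κE` of a field `E` of characteristic `0` with topological generator `g` and ANY discrete `Γ_E`-module
`M` with continuous orbit maps (no divisibility, no finiteness hypothesis; both sides as `Nat.card`). §1 with the
inflation cocycles of §2. Used with `M = Ê(𝔪̄)` (the formal group inside `E(K̄_v)`) for the factor `|ker(a_v)|` of
Greenberg's Lemma 3.4. [cite: GreenbergLNM1716, §3 Lemmas 3.1–3.4 (pp. 86–89)] [cite: SerreGaloisCohomology1997, XIII.§1] -/
theorem natCard_primary_subgroupResKer_eq_of_isTopGenerator {g : Field.absoluteGaloisGroup E}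
    (hγ : κE.IsTopGenerator g) {M : Type u} [AddCommGroup M] [DistribMulAction (Field.absoluteGaloisGroup E) M]
    [TopologicalSpace M] [DiscreteTopology M]
    (hcont : ∀ m : M, Continuous fun σ : Field.absoluteGaloisGroup E ↦ σ • m) :
    Nat.card {x : subgroupResKer M κE.kerSubgroup // ∃ k : ℕ, p ^ k • x = 0} =
      Nat.card (AddCommGroup.primaryComponent
        (FixedPoints.addSubgroup κE.kerSubgroup M ⧸ (subOne κE.kerSubgroup M g).range) p) := by
  refine natCard_primary_subgroupResKer_eq_of_cocycles κE.kerSubgroup M g (fun U hU hNU hgU ↦ ?_) hcont p ?_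
  · -- `ker κE` and `g` generate `Γ_E` topologically
    rw [eq_top_iff, ← ZpExtension.layerSubgroup_zero (κ := κE)]
    exact κE.layerSubgroup_le_of_isOpen hγ 0 U hU hNU (by rwa [pow_zero, pow_one])
  · -- inflation cocycles for the `p`-power-torsion classes
    rintro b ⟨k, hk⟩
    rw [← QuotientAddGroup.mk_nsmul, QuotientAddGroup.eq_zero_iff] at hk
    obtain ⟨y, hy⟩ := hk
    have hbk : p ^ k • (b : M) = g • (y : M) - y := by
      have h := congrArg (fun z : FixedPoints.addSubgroup κE.kerSubgroup M ↦ (z : M)) hy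
      simp only [coe_subOne_apply, AddSubmonoidClass.coe_nsmul] at h
      exact h.symm
    obtain ⟨ψ, hψN, hψg⟩ := κE.exists_cocycle_vanishing_apply_eq_of_nsmul_eq_sub hγ hcont (b : M)
      (fun τ hτ ↦ b.2 ⟨τ, hτ⟩) (fun τ hτ ↦ y.2 ⟨τ, hτ⟩) hbk
    exact ⟨ψ, hψN, hψg⟩

variable {K : Type u} [Field K] (W : WeierstrassCurve K) (κ : ZpExtension K p) [Algebra K E]

set_option maxHeartbeats 800000 in
/-- **`#𝒦_{E,0}[p^∞] = #(E(K̄_E)^{H_{E,∞}}/(g − 1))[p^∞]` for every topological generator `g` of every local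
`ℤ_p`-extension with kernel `H_{E,∞}`** — the EQUALITY form of the tree's `finite_localTowerKerPrimary_and_card_le` at
`n = 0` with NO divisibility hypothesis (compare `Rank1Residual.Additive.natCard_localTowerKerPrimary_zero_eq`, which
needs «`E(K_∞·E)` `p`-divisible modulo torsion», false at `v ∣ p`). For an elliptic curve `W/K`, a `ℤ_p`-extension `κ`
of `K`, a `K`-field `E` of characteristic `0`, a `ℤ_p`-extension `κE` of `E` with `ker κE = Gal(K̄_E/K_∞·E)`
(`localSubgroup κ.kerSubgroup E`) and `κE g = 1`: both sides as `Nat.card` (finite or not). Ingredients: file 52's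
transport `𝒦_{E,0} = ker(res : H¹(H_{E,0}, E(K̄_E)) → H¹(H_{E,∞}, ·))`, §1, and the inflation cocycles of §2 pulled back
to `H_{E,0}`. Greenberg, LNM 1716, §3: "`ker(r_v) ≅ H¹(Γ_v, E(K_{∞,η}))`" with `Γ_v` pro-cyclic.
[cite: GreenbergLNM1716, §3 Lemmas 3.3–3.4 (pp. 86–89)] [cite: SerreGaloisCohomology1997, I.§2.6, XIII.§1] -/
theorem natCard_localTowerKerPrimary_zero_eq_of_isTopGenerator
    (hker : κE.kerSubgroup = localSubgroup κ.kerSubgroup E)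
    {g : Field.absoluteGaloisGroup E} (hγ : κE.IsTopGenerator g) :
    Nat.card (W.localTowerKerPrimary κ E 0) =
      Nat.card (AddCommGroup.primaryComponent
        (FixedPoints.addSubgroup (localSubgroup κ.kerSubgroup E) (localPoints W E) ⧸
          (subOne (localSubgroup κ.kerSubgroup E) (localPoints W E) g).range) p) := by
  -- adapted from Summits/BirchSwinnertonDyer/Rank1Residual/Additive/LocalTowerKernelPrimaryExact.lean (file 52)
  -- notation (as in the tree's `finite_localTowerKerPrimary_and_card_le`)
  let P : Type u := localPoints W E
  let Hn : Subgroup (Field.absoluteGaloisGroup E) := localSubgroup (κ.layerSubgroup 0) E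
  let Hi : Subgroup (Field.absoluteGaloisGroup E) := localSubgroup κ.kerSubgroup E
  let N : Subgroup Hn := Hi.subgroupOf Hn
  have hmem0 : ∀ σ : Field.absoluteGaloisGroup E, σ ∈ Hn := fun σ ↦ by
    change σ ∈ localSubgroup (κ.layerSubgroup 0) E
    rw [mem_localSubgroup_iff, layerSubgroup_zero]; exact Subgroup.mem_top _
  have hg : g ∈ Hn := hmem0 g
  let γ : Hn := ⟨g, hg⟩
  have hle : Hi ≤ Hn := WeierstrassCurve.localSubgroup_ker_le_layer κ E 0
  -- (1) generation inside `H_{E,0}` (from `κE`)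
  have hgen : ∀ U : Subgroup (Field.absoluteGaloisGroup E),
      IsOpen (U : Set (Field.absoluteGaloisGroup E)) → Hi ≤ U → g ∈ U → Hn ≤ U := by
    intro U hU hNU hgU σ _
    have h := κE.layerSubgroup_le_of_isOpen hγ 0 U hU (by rw [hker]; exact hNU) (by rwa [pow_zero, pow_one])
    exact h (by rw [layerSubgroup_zero]; exact Subgroup.mem_top σ)
  have hgen' : ∀ U : Subgroup Hn, IsOpen (U : Set Hn) → N ≤ U → γ ∈ U → U = ⊤ := by
    intro U hU hNU hγU
    let U' : Subgroup (Field.absoluteGaloisGroup E) := U.map Hn.subtype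
    have hopen : IsOpen (U' : Set (Field.absoluteGaloisGroup E)) :=
      (isOpen_localSubgroup_layerSubgroup E κ 0).isOpenMap_subtype_val _ hU
    have hN' : Hi ≤ U' := fun τ hτ ↦
      ⟨⟨τ, hle hτ⟩, hNU (Subgroup.mem_subgroupOf.mpr hτ), rfl⟩
    have hγU' : g ∈ U' := ⟨γ, hγU, rfl⟩
    have hle' := hgen U' hopen hN' hγU'
    rw [eq_top_iff]
    intro x _
    obtain ⟨u, hu, hux⟩ := hle' x.2
    have : u = x := Subtype.ext hux
    exact this ▸ hu
  -- (2) orbit maps on `H_{E,0}`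
  have hcont : ∀ m : P, Continuous fun x : Hn ↦ x • m := fun m ↦
    (continuous_smul_localPoints W E m).comp continuous_subtype_val
  -- (3) `P^N = P^{H_{E,∞}}`, compatibly with `g − 1` and `p`-power torsion
  have hfix : FixedPoints.addSubgroup N P = FixedPoints.addSubgroup Hi P := by
    ext m
    simp only [FixedPoints.mem_addSubgroup]
    constructor
    · intro h τ
      exact h ⟨⟨τ, hle τ.2⟩, Subgroup.mem_subgroupOf.mpr τ.2⟩
    · intro h x
      exact h ⟨((x : Hn) : Field.absoluteGaloisGroup E), Subgroup.mem_subgroupOf.mp x.2⟩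
  let e : FixedPoints.addSubgroup N P ≃+ FixedPoints.addSubgroup Hi P :=
    AddEquiv.addSubgroupCongr hfix
  have he : AddSubgroup.map (e : FixedPoints.addSubgroup N P →+ FixedPoints.addSubgroup Hi P)
      (subOne N P γ).range = (subOne Hi P g).range := by
    ext b
    constructor
    · rintro ⟨x, ⟨y, rfl⟩, rfl⟩
      exact ⟨e y, Subtype.ext rfl⟩
    · rintro ⟨y, rfl⟩
      exact ⟨subOne N P γ (e.symm y), ⟨e.symm y, rfl⟩, Subtype.ext rfl⟩
  let eq : FixedPoints.addSubgroup N P ⧸ (subOne N P γ).range ≃+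
      FixedPoints.addSubgroup Hi P ⧸ (subOne Hi P g).range :=
    QuotientAddGroup.congr _ _ e he
  let ep : AddCommGroup.primaryComponent (FixedPoints.addSubgroup N P ⧸ (subOne N P γ).range) p ≃
      AddCommGroup.primaryComponent (FixedPoints.addSubgroup Hi P ⧸ (subOne Hi P g).range) p :=
    eq.toEquiv.subtypeEquiv fun a ↦ by
      simp only [AddCommGroup.mem_primaryComponent, AddEquiv.toEquiv_eq_coe, EquivLike.coe_coe]
      constructor
      · rintro ⟨k, hk⟩
        exact ⟨k, by rw [← map_nsmul, hk, map_zero]⟩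
      · rintro ⟨k, hk⟩
        refine ⟨k, eq.injective ?_⟩
        rw [map_nsmul, hk, map_zero]
  have hcardp : Nat.card (AddCommGroup.primaryComponent
      (FixedPoints.addSubgroup N P ⧸ (subOne N P γ).range) p) =
      Nat.card (AddCommGroup.primaryComponent
        (FixedPoints.addSubgroup Hi P ⧸ (subOne Hi P g).range) p) :=
    Nat.card_congr ep
  -- (hinf): inflation cocycles for torsion classes, from `κE` (§2), pulled back to `H_{E,0}`
  have hinfN : ∀ b : FixedPoints.addSubgroup N P,
      (∃ k : ℕ, p ^ k • (QuotientAddGroup.mk b : FixedPoints.addSubgroup N P ⧸ (subOne N P γ).range) = 0) →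
      ∃ ψ : contOneCocycles (discreteTopRep Hn P), (∀ n ∈ N, ψ.1 n = 0) ∧ ψ.1 γ = b := by
    rintro b ⟨k, hk⟩
    rw [← QuotientAddGroup.mk_nsmul, QuotientAddGroup.eq_zero_iff] at hk
    obtain ⟨y, hy⟩ := hk
    have hbk : p ^ k • (b : P) = g • (y : P) - y := by
      have h := congrArg (fun z : FixedPoints.addSubgroup N P ↦ (z : P)) hy
      simp only [coe_subOne_apply, AddSubmonoidClass.coe_nsmul] at h
      exact h.symm
    have hHi : ∀ τ ∈ κE.kerSubgroup, τ ∈ Hi := fun τ hτ ↦ by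
      change τ ∈ localSubgroup κ.kerSubgroup E
      rw [← hker]; exact hτ
    have hbfix : ∀ τ ∈ κE.kerSubgroup, τ • (b : P) = b := fun τ hτ ↦ (e b).2 ⟨τ, hHi τ hτ⟩
    have hyfix : ∀ τ ∈ κE.kerSubgroup, τ • (y : P) = y := fun τ hτ ↦ (e y).2 ⟨τ, hHi τ hτ⟩
    obtain ⟨ψ, hψN, hψg⟩ := κE.exists_cocycle_vanishing_apply_eq_of_nsmul_eq_sub hγ
      (continuous_smul_localPoints W E) (b : P) hbfix hyfix hbk
    refine ⟨contOneCocycles.pullback (Literature.NumberTheory.EllipticCurves.subgroupIncl Hn)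
      (resHomOfEquivariant (Literature.NumberTheory.EllipticCurves.subgroupIncl Hn) (AddMonoidHom.id P)
        (fun _ _ ↦ rfl)) ψ, fun n hn ↦ ?_, ?_⟩
    · rw [pullback_subtype_apply]
      exact hψN _ (by rw [hker]; exact Subgroup.mem_subgroupOf.mp hn)
    · rw [pullback_subtype_apply]
      exact hψg
  -- (4) the generic count on `H_{E,0}`
  have hcount := natCard_primary_subgroupResKer_eq_of_cocycles N P γ hgen' hcont p hinfN
  -- (5) `𝒦_{E,0} = ker (res : H¹(H_{E,0}, P) → H¹(N, P))`
  let j : N →ₜ* Hi :=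
    { toFun := fun x ↦ ⟨((x : Hn) : Field.absoluteGaloisGroup E), Subgroup.mem_subgroupOf.mp x.2⟩
      map_one' := rfl
      map_mul' := fun _ _ ↦ rfl
      continuous_toFun :=
        (continuous_subtype_val.comp continuous_subtype_val).subtype_mk _ }
  have hcomp : (resH1Hom j (AddMonoidHom.id P) (fun _ _ ↦ rfl)).comp
      (Literature.NumberTheory.EllipticCurves.resOfLe P hle) = resSubgroup N P := by
    unfold Literature.NumberTheory.EllipticCurves.resOfLe ResKernel.resSubgroup
    rw [resH1Hom_comp]
    exact resH1Hom_congr (ContinuousMonoidHom.ext fun _ ↦ rfl) (AddMonoidHom.ext fun _ ↦ rfl) _ _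
  have hkerEq : W.localTowerKer κ E 0 = subgroupResKer P N := by
    apply le_antisymm
    · intro c hc
      rw [mem_subgroupResKer_iff, ← hcomp, AddMonoidHom.comp_apply,
        (W.mem_localTowerKer_iff κ E 0 c).mp hc, map_zero]
    · intro c hc
      obtain ⟨φ, rfl, hφN⟩ := exists_cocycle_of_res_eq_zero N P hcont c hc
      rw [W.mem_localTowerKer_iff κ E 0]
      change Literature.NumberTheory.EllipticCurves.resOfLe P hle (oneCocycleClass _ φ) = 0
      have h0 : oneCocycleClass _ (contOneCocycles.pullback (subgroupInclusion hle)
          (resHomOfEquivariant (subgroupInclusion hle) (AddMonoidHom.id P) (fun _ _ ↦ rfl)) φ) = 0 := by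
        rw [oneCocycleClass_eq_zero_iff]
        refine ⟨0, fun τ ↦ ?_⟩
        rw [map_zero, sub_zero, contOneCocycles.pullback_apply]
        exact hφN ⟨(τ : Field.absoluteGaloisGroup E), hle τ.2⟩ (Subgroup.mem_subgroupOf.mpr τ.2)
      rw [← map_oneCocycleClass] at h0
      exact h0
  -- (6) `𝒦_{E,0}[p^∞] ≃ {x ∈ ker res | p-power torsion}`
  let f : W.localTowerKerPrimary κ E 0 ≃ {x : subgroupResKer P N // ∃ k : ℕ, p ^ k • x = 0} :=
    { toFun := fun c ↦ ⟨⟨(c : discreteH1 Hn P), hkerEq.le ((W.mem_localTowerKerPrimary_iff κ E 0 _).mp c.2).1⟩, by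
        obtain ⟨k, hk⟩ := ((W.mem_localTowerKerPrimary_iff κ E 0 _).mp c.2).2
        exact ⟨k, Subtype.ext hk⟩⟩
      invFun := fun x ↦ ⟨((x.1 : subgroupResKer P N) : discreteH1 Hn P),
        (W.mem_localTowerKerPrimary_iff κ E 0 _).mpr ⟨hkerEq.symm.le x.1.2, by
          obtain ⟨k, hk⟩ := x.2
          exact ⟨k, by
            have := congrArg (fun z : subgroupResKer P N ↦ (z : discreteH1 Hn P)) hk
            simpa only [AddSubgroupClass.coe_nsmul, ZeroMemClass.coe_zero] using this⟩⟩⟩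
      left_inv := fun c ↦ Subtype.ext rfl
      right_inv := fun x ↦ Subtype.ext (Subtype.ext rfl) }
  rw [Nat.card_congr f, hcount, hcardp]

end Local

end Summit.BirchSwinnertonDyer.BirchSwinnertonDyer.Theorems.InputsGreenbergLemma34

end
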